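import Summits.CriticalPhenomena.PercolationContinuityZ3.Theorems.PercNearOneGluingNoHeavyLowerTailAntiBandDetCriterion
import Summits.CriticalPhenomena.PercolationContinuityZ3.Theorems.PercNearOneGluingNoHeavyLowerTailAntiBandDiagGap
import Summits.CriticalPhenomena.PercolationContinuityZ3.Theorems.PercNearOneGluingNoHeavyLowerTailAntiBandGramK2

/-!
# `NoHeavyLowerTail` (crux stmt-CriticalPhenomena-4575), lane prim-ineq-gen-4 (gen 27): (AB_3)(6) IN THE KERNEL — g26 THEOREM A at `k = 2`

Support file (`--supports stmt-CriticalPhenomena-4575`).  No definitions, no `sorry`, standard axioms.  Assembly of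
`AntiBandBlockCount.qform_ball_nonneg_k2` (type-free Gram identity: the universal kernel `Q_ball` is PSD at `(6,2)`),
`AntiBandDiagGap.det_binomial_ne_zero_of_qform_nonneg` (the diagonal GAP chain) and `AntiBandDetCriterion.antiBand_of_det_binomial_ne_zero` (gen 21):
**for every 6-element `β` and all upper sets `A, V` of finsets of `β`, the anti-band inequality (AB_3) holds** (`antiBand_three_of_card_six`).
Previously (AB_3)(6) was known only by exhaustive enumeration / a DRAT certificate; this is the uniform spectral-gap proof of FINDING-SPECTRAL-GAP-g26, formalised.
-/

namespace Summit.CriticalPhenomena.PercolationContinuityZ3.Theorems.AntiBandThreeSix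

open Finset Matrix
open scoped FinsetFamily

variable {β : Type*} [DecidableEq β] [Fintype β]

/-- `Q_UU ⪰ 0` for every family `U` of finsets of size `≤ 2` in a 6-element type (restriction of `qform_ball_nonneg_k2` to vectors supported on `U`). [gen 27] -/
theorem qform_nonneg_on_family (hβ : Fintype.card β = 6) (U : Finset (Finset β)) (hUk : ∀ x ∈ U, #x ≤ 2) (g : ↥U → ℚ) :
    0 ≤ ∑ z : ↥U, ∑ z' : ↥U, g z * g z' *
        ((((2 * 2 + 2 - #((z : Finset β) ∪ z')).choose (2 + 1) : ℕ) : ℚ)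
          - (if (z : Finset β) ⊆ z' then 1 else 0) - (if (z' : Finset β) ⊆ z then 1 else 0)) := by
  classical
  set x : Finset β → ℚ := fun a => if h : a ∈ U then g ⟨a, h⟩ else 0 with hxdef
  have hpos := AntiBandBlockCount.qform_ball_nonneg_k2 hβ x
  set ball := (univ : Finset β).powerset.filter (fun a => #a ≤ 2) with hball
  have hUball : U ⊆ ball := by
    intro a ha; rw [hball, mem_filter, mem_powerset]; exact ⟨subset_univ _, hUk a ha⟩
  set q : Finset β → Finset β → ℚ := fun a b =>
    ((((6 - #(a ∪ b)).choose 3 : ℕ) : ℚ) - (if a ⊆ b then 1 else 0) - (if b ⊆ a then 1 else 0)) with hqdef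
  have hx0 : ∀ a, a ∉ U → x a = 0 := by
    intro a ha; simp [hxdef, ha]
  -- restrict the double sum over the ball to `U`
  have h1 : ∑ a ∈ ball, ∑ b ∈ ball, x a * x b * q a b = ∑ a ∈ U, ∑ b ∈ U, x a * x b * q a b := by
    symm
    apply Finset.sum_subset_zero_on_sdiff hUball
    · intro a ha
      rw [mem_sdiff] at ha
      apply Finset.sum_eq_zero
      intro b _
      rw [hx0 a ha.2]; ring
    · intro a _
      apply Finset.sum_subset_zero_on_sdiff hUball
      · intro b hb
        rw [mem_sdiff] at hb
        rw [hx0 b hb.2]; ring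
      · intro b _; rfl
  have h2 : ∑ a ∈ U, ∑ b ∈ U, x a * x b * q a b = ∑ z : ↥U, ∑ z' : ↥U, g z * g z' * q z z' := by
    rw [← Finset.sum_coe_sort U]
    apply Finset.sum_congr rfl
    intro z _
    rw [← Finset.sum_coe_sort U]
    apply Finset.sum_congr rfl
    intro z' _
    have hz : x z = g z := by simp [hxdef, z.2]
    have hz' : x z' = g z' := by simp [hxdef, z'.2]
    rw [hz, hz']
  have h3 : ∑ z : ↥U, ∑ z' : ↥U, g z * g z' *
        ((((2 * 2 + 2 - #((z : Finset β) ∪ z')).choose (2 + 1) : ℕ) : ℚ)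
          - (if (z : Finset β) ⊆ z' then 1 else 0) - (if (z' : Finset β) ⊆ z then 1 else 0))
      = ∑ z : ↥U, ∑ z' : ↥U, g z * g z' * q z z' := by
    apply Finset.sum_congr rfl; intro z _
    apply Finset.sum_congr rfl; intro z' _
    simp only [hqdef]
  rw [h3, ← h2, ← h1]
  exact hpos

/-- **(AB_3)(6), kernel version (g26 THEOREM A for k = 2).**  For every finite type `β` with `|β| = 6` and all upper sets `A`, `V` of finsets of `β`:
`#{s ∈ A ∩ Vᶜˢ | #s < 3 ∨ #sᶜ < 3} ≤ #{s ∈ A ∩ V | #s < 3 ∨ #sᶜ < 3}`.  [gen 27: Gram identity + GAP chain + determinant criterion] -/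
theorem antiBand_three_of_card_six (hβ : Fintype.card β = 6) (A V : Finset (Finset β))
    (hA : IsUpperSet (A : Set (Finset β))) (hV : IsUpperSet (V : Set (Finset β))) :
    #((A ∩ Vᶜˢ).filter fun s => #s < 3 ∨ #sᶜ < 3) ≤ #((A ∩ V).filter fun s => #s < 3 ∨ #sᶜ < 3) := by
  apply AntiBandDetCriterion.antiBand_of_det_binomial_ne_zero 3 (by norm_num) A V hA hV (by omega)
  have hUk : ∀ x ∈ A.filter (fun s => #s < 3), #x ≤ 2 := by
    intro x hx; rw [mem_filter] at hx; omega
  have hup : ∀ x ∈ A.filter (fun s => #s < 3), ∀ z : Finset β, x ⊆ z → #z ≤ 2 → z ∈ A.filter (fun s => #s < 3) := by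
    intro x hx z hxz hz
    rw [mem_filter] at hx ⊢
    exact ⟨hA hxz hx.1, by omega⟩
  have h := AntiBandDiagGap.det_binomial_ne_zero_of_qform_nonneg 2 (by omega) (A.filter fun s => #s < 3) hUk hup
    (qform_nonneg_on_family hβ (A.filter fun s => #s < 3) hUk)
  exact h

end Summit.CriticalPhenomena.PercolationContinuityZ3.Theorems.AntiBandThreeSix
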